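import Summits.QuantumAdvantage.QuantumAdvantage.Theorems.LinnikCubicClassGroupsDegreeOnePrimesEscapeConjInvariantPNT
import HarnessLib

/-!
# The Chebotarev prime number theorem in the Linnik range for class functions

Topic `Summits/QuantumAdvantage/QuantumAdvantage/Theorems`, cell B2b-1 (linnik-cubic), PART A (gen 14);
helper toward the crux `DegreeOnePrimesEscape` (stmt-QuantumAdvantage-11543) of route
`LinnikCubicClassGroups`.  HONEST FRAMING: the value of this file is a THEOREM (kernel-checked, GRH-free,
Siegel-free, no hypothesis) — NOT summit progress.

**Theorem** (`classFunction_PNT`).  For `n > 1` and `0 < ε ≤ 1` there are `L, c > 0` such that every Galois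
number field `N/ℚ` of degree `n` carries `θ ∈ {0,1}`, `β₁ ∈ (1 − c/(log|d_N| + log 4), 1)` and `K₁ ⊴ G`
as in `conjInvariant_PNT_pi`, with the following property.  Let `φ : G → ℝ` be a class function and
`Fr : ℕ → G` any choice of Frobenius elements (`Fr p` an arithmetic Frobenius at some prime of `N` above `p`
with trivial inertia, for every prime `p ∤ d_N`).  Then for every `x ≥ |d_N|^L`, with
`χ₁ = 𝟙_{K₁} − 𝟙_{G ∖ K₁}`,

  `|Σ_{p ≤ x, p ∤ d_N} φ(Fr p) − (Σ_g φ(g) · Li(x) − θ · Σ_g φ(g)χ₁(g) · Li(x^{β₁})) / |G||`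
  `≤ ε · Σ_g |φ(g)| · (Li(x) + θ Li(x^{β₁})) / |G|`.

This is the class-function form of [LagariasMontgomeryOdlyzko1979, Theorem 1.1] (as used e.g. in Serre,
*Quelques applications du théorème de densité de Chebotarev*, §2), unconditional, inexplicit `L(n, ε)`:
decompose `φ` along its level sets (conjugation-invariant), apply `conjInvariant_PNT_pi` to each, and sum.
-/

noncomputable section

open scoped NumberField nonZeroDivisors
open Finset Real Ideal NumberField
open Literature.NumberTheory.NumberFields Literature.NumberTheory.LFunctions
  Literature.NumberTheory.LFunctions.NumberField

namespace Summit.QuantumAdvantage.QuantumAdvantage.Theorems.DegreeOnePrimesEscape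

/-! ### Finite sums along level sets -/

/-- Summing `w ∘ u` over `t` along the level sets of `u`. -/
theorem sum_eq_sum_card_filter_mul {ι : Type*} (t : Finset ι) (u : ι → ℝ) (V : Finset ℝ)
    (hV : ∀ i ∈ t, u i ∈ V) (w : ℝ → ℝ) [DecidableEq ι] :
    ∑ i ∈ t, w (u i) = ∑ v ∈ V, (((t.filter fun i => u i = v).card : ℕ) : ℝ) * w v := by
  classical
  rw [← Finset.sum_fiberwise_of_maps_to (g := u) (fun i hi => hV i hi)]
  refine Finset.sum_congr rfl fun v _ => ?_
  rw [Finset.sum_congr rfl (fun i hi => by rw [(Finset.mem_filter.mp hi).2] : ∀ i ∈ t.filter (fun i => u i = v),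
    w (u i) = w v), Finset.sum_const, nsmul_eq_mul]

/-- Summing any `F` over `t` along the level sets of `u`. -/
theorem sum_eq_sum_sum_filter {ι : Type*} (t : Finset ι) (u : ι → ℝ) (V : Finset ℝ)
    (hV : ∀ i ∈ t, u i ∈ V) (F : ι → ℝ) [DecidableEq ι] :
    ∑ i ∈ t, F i = ∑ v ∈ V, ∑ i ∈ t.filter (fun i => u i = v), F i := by
  classical
  rw [← Finset.sum_fiberwise_of_maps_to (g := u) (fun i hi => hV i hi)]

variable {N : Type} [Field N] [NumberField N] [IsGalois ℚ N]

omit [IsGalois ℚ N] in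
open scoped Classical in
/-- The level sets of a class function are conjugation-invariant. -/
theorem conjInvariant_levelSet (φ : (N ≃ₐ[ℚ] N) → ℝ) (hφ : ∀ g h : N ≃ₐ[ℚ] N, φ (h * g * h⁻¹) = φ g)
    (v : ℝ) : ∀ g h : N ≃ₐ[ℚ] N, g ∈ {g : N ≃ₐ[ℚ] N | φ g = v} → h * g * h⁻¹ ∈ {g : N ≃ₐ[ℚ] N | φ g = v} := by
  intro g h hg
  rw [Set.mem_setOf_eq, hφ]; exact hg

omit [IsGalois ℚ N] in
open scoped Classical in
/-- Cardinalities of level sets as filter cardinalities. -/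
theorem natCard_levelSet_eq (φ : (N ≃ₐ[ℚ] N) → ℝ) (v : ℝ) (K : Subgroup (N ≃ₐ[ℚ] N)) :
    (Nat.card ({g : N ≃ₐ[ℚ] N | φ g = v} : Set (N ≃ₐ[ℚ] N)) =
      (Finset.univ.filter fun g : N ≃ₐ[ℚ] N => φ g = v).card) ∧
    (Nat.card {g : N ≃ₐ[ℚ] N // g ∈ ({g : N ≃ₐ[ℚ] N | φ g = v} : Set (N ≃ₐ[ℚ] N)) ∧ g ∈ K} =
      ((Finset.univ.filter fun g : N ≃ₐ[ℚ] N => φ g = v).filter fun g => g ∈ K).card) ∧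
    (Nat.card {g : N ≃ₐ[ℚ] N // g ∈ ({g : N ≃ₐ[ℚ] N | φ g = v} : Set (N ≃ₐ[ℚ] N)) ∧ g ∉ K} =
      ((Finset.univ.filter fun g : N ≃ₐ[ℚ] N => φ g = v).filter fun g => g ∉ K).card) := by
  refine ⟨?_, ?_, ?_⟩
  · rw [Nat.card_eq_fintype_card, ← Fintype.card_subtype]; rfl
  · rw [Nat.card_eq_fintype_card, Fintype.card_subtype, Finset.filter_filter]; rfl
  · rw [Nat.card_eq_fintype_card, Fintype.card_subtype, Finset.filter_filter]; rfl

omit [IsGalois ℚ N] in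
open scoped Classical in
/-- `Σ_{φ = v} χ₁ = |{φ = v} ∩ K₁| − |{φ = v} ∖ K₁|`. -/
theorem sum_filter_sign_eq (φ : (N ≃ₐ[ℚ] N) → ℝ) (v : ℝ) (K : Subgroup (N ≃ₐ[ℚ] N)) :
    ∑ g ∈ Finset.univ.filter (fun g : N ≃ₐ[ℚ] N => φ g = v), (if g ∈ K then (1 : ℝ) else -1) =
      (((Finset.univ.filter fun g : N ≃ₐ[ℚ] N => φ g = v).filter fun g => g ∈ K).card : ℝ) -
      (((Finset.univ.filter fun g : N ≃ₐ[ℚ] N => φ g = v).filter fun g => g ∉ K).card : ℝ) := by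
  rw [← Finset.sum_filter_add_sum_filter_not _ (fun g : N ≃ₐ[ℚ] N => g ∈ K)]
  rw [Finset.sum_congr rfl (fun g hg => by rw [if_pos (Finset.mem_filter.mp hg).2] :
      ∀ g ∈ (Finset.univ.filter fun g : N ≃ₐ[ℚ] N => φ g = v).filter (fun g => g ∈ K),
        (if g ∈ K then (1 : ℝ) else -1) = 1),
    Finset.sum_congr rfl (fun g hg => by rw [if_neg (Finset.mem_filter.mp hg).2] :
      ∀ g ∈ (Finset.univ.filter fun g : N ≃ₐ[ℚ] N => φ g = v).filter (fun g => ¬ g ∈ K),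
        (if g ∈ K then (1 : ℝ) else -1) = -1),
    Finset.sum_const, Finset.sum_const, nsmul_eq_mul, nsmul_eq_mul]
  ring

set_option maxHeartbeats 4000000 in
open scoped Classical in
/-- **The Chebotarev prime number theorem in the Linnik range for class functions** (see the module
docstring).  Unconditional. [cite: LagariasMontgomeryOdlyzko1979, Theorem 1.1]
[cite: ThornerZaman2019, Theorem 1.4] -/
theorem classFunction_PNT (n : ℕ) (hn : 1 < n) {ε : ℝ} (hε : 0 < ε) (hε1 : ε ≤ 1) :
    ∃ L c : ℝ, 0 < L ∧ 0 < c ∧ c ≤ 1 / 4 ∧ ∀ (N : Type) [Field N] [NumberField N] [IsGalois ℚ N],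
      Module.finrank ℚ N = n →
      ∃ (θ β₁ : ℝ) (K₁ : Subgroup (N ≃ₐ[ℚ] N)), (θ = 0 ∨ θ = 1) ∧ K₁.Normal ∧
        1 - c / (Real.log ((NumberField.discr N).natAbs : ℝ) + Real.log 4) < β₁ ∧ β₁ < 1 ∧
        (θ = 1 → dedekindZeta₁ N β₁ = 0 ∧ K₁.index = 2 ∧
          ∀ H : Subgroup (N ≃ₐ[ℚ] N),
            dedekindZeta₁ (IntermediateField.fixedField H) β₁ = 0 ↔ H ≤ K₁) ∧
        (θ = 0 → K₁ = ⊤ ∧ ¬ ∃ β : ℝ, dedekindZeta₁ N β = 0 ∧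
          1 - c / (Real.log ((NumberField.discr N).natAbs : ℝ) + Real.log 4) < β ∧ β < 1) ∧
        ∀ φ : (N ≃ₐ[ℚ] N) → ℝ, (∀ g h : N ≃ₐ[ℚ] N, φ (h * g * h⁻¹) = φ g) →
        ∀ Fr : ℕ → (N ≃ₐ[ℚ] N),
          (∀ p : ℕ, p.Prime → ¬ ((p : ℤ) ∣ NumberField.discr N) →
            ∃ (Q : Ideal (𝓞 N)) (_ : Q.IsMaximal) (_ : Q.LiesOver (span {(p : ℤ)})),
              IsArithFrobAt ℤ (Fr p) Q ∧ Q.inertia (N ≃ₐ[ℚ] N) = ⊥) →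
          ∀ x : ℝ, ((NumberField.discr N).natAbs : ℝ) ^ L ≤ x →
            |(∑ p ∈ (Nat.primesLE ⌊x⌋₊).filter (fun p : ℕ => ¬ ((p : ℤ) ∣ NumberField.discr N)),
                φ (Fr p)) -
              ((∑ g : N ≃ₐ[ℚ] N, φ g) * offsetLogIntegral x -
                θ * (∑ g : N ≃ₐ[ℚ] N, φ g * (if g ∈ K₁ then (1 : ℝ) else -1)) *
                  offsetLogIntegral (x ^ β₁)) / Nat.card (N ≃ₐ[ℚ] N)| ≤
              ε * ((∑ g : N ≃ₐ[ℚ] N, |φ g|) * (offsetLogIntegral x + θ * offsetLogIntegral (x ^ β₁)) /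
                Nat.card (N ≃ₐ[ℚ] N)) := by
  obtain ⟨L₀, c, hL₀, hc, hc4, h⟩ := conjInvariant_PNT_pi n hn hε hε1
  set L : ℝ := max L₀ 1 with hL
  refine ⟨L, c, lt_of_lt_of_le hL₀ (le_max_left _ _), hc, hc4, fun N _ _ _ hN => ?_⟩
  obtain ⟨θ, β₁, K₁, hθ, hK₁n, hβ₁c, hβ₁1, h1, h0, hS⟩ := h N hN
  refine ⟨θ, β₁, K₁, hθ, hK₁n, hβ₁c, hβ₁1, h1, h0, fun φ hφ Fr hFr x hx => ?_⟩
  have hN1 : 1 < Module.finrank ℚ N := by rw [hN]; exact hn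
  set d : ℝ := ((NumberField.discr N).natAbs : ℝ) with hd
  have hd3 : (3 : ℝ) ≤ d := three_le_natAbs_discr_real N hN1
  have hd1 : (1 : ℝ) ≤ d := by linarith
  have hx₀ : d ^ L₀ ≤ x := (Real.rpow_le_rpow_of_exponent_le hd1 (le_max_left _ _)).trans hx
  have hx3 : (3 : ℝ) ≤ x := by
    have := (Real.rpow_le_rpow_of_exponent_le hd1 (le_max_right L₀ 1)).trans hx
    rw [Real.rpow_one] at this; linarith
  have hx1 : 1 < x := by linarith
  have hG0 : (0 : ℝ) < Nat.card (N ≃ₐ[ℚ] N) := by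
    have : 0 < Nat.card (N ≃ₐ[ℚ] N) := Nat.card_pos
    exact_mod_cast this
  -- `θ Li(x^{β₁}) ≥ 0`
  have hθLi : 0 ≤ θ * offsetLogIntegral (x ^ β₁) := by
    rcases hθ with hθ0 | hθ1
    · rw [hθ0, zero_mul]
    · obtain ⟨hζ₁, -, -⟩ := h1 hθ1
      have hβ34 : 3 / 4 ≤ β₁ := three_quarters_le_of_window hc hc4 hd3 hβ₁c
      have hxβ : (2 : ℝ) ≤ x ^ β₁ := by
        have h9 : (3 : ℝ) ^ ((3 : ℝ) / 4) ≤ x ^ β₁ :=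
          (Real.rpow_le_rpow (by norm_num) hx3 (by norm_num)).trans
            (Real.rpow_le_rpow_of_exponent_le hx1.le hβ34)
        have h8 : (2 : ℝ) ≤ (3 : ℝ) ^ ((3 : ℝ) / 4) := by
          have h16 : ((2 : ℝ) ^ (4 : ℕ) : ℝ) ≤ (3 : ℝ) ^ (3 : ℕ) := by norm_num
          have : ((2 : ℝ) ^ (4 : ℝ)) ^ ((1 : ℝ) / 4) ≤ ((3 : ℝ) ^ (3 : ℝ)) ^ ((1 : ℝ) / 4) := by
            apply Real.rpow_le_rpow (by positivity) _ (by norm_num)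
            rw [show (4 : ℝ) = ((4 : ℕ) : ℝ) by norm_num, show (3 : ℝ) = ((3 : ℕ) : ℝ) by norm_num,
              Real.rpow_natCast, Real.rpow_natCast]
            exact_mod_cast h16
          rw [← Real.rpow_mul (by norm_num), ← Real.rpow_mul (by norm_num)] at this
          norm_num at this
          exact this
        linarith
      have hLi0 : 0 ≤ offsetLogIntegral (x ^ β₁) := by
        rw [offsetLogIntegral]
        exact intervalIntegral.integral_nonneg hxβ fun t ht => by
          have : 1 < t := by linarith [ht.1]
          exact inv_nonneg.mpr (Real.log_nonneg this.le)
      rw [hθ1, one_mul]; exact hLi0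
  -- notation
  set V : Finset ℝ := Finset.univ.image φ with hV
  set s : Finset ℕ := (Nat.primesLE ⌊x⌋₊).filter (fun p : ℕ => ¬ ((p : ℤ) ∣ NumberField.discr N)) with hs
  set G₀ : ℝ := (Nat.card (N ≃ₐ[ℚ] N) : ℝ) with hG₀
  set Li : ℝ := offsetLogIntegral x with hLi
  set Lb : ℝ := offsetLogIntegral (x ^ β₁) with hLb
  -- the per-level-set counts
  set πv : ℝ → ℝ := fun v => (((s.filter fun p : ℕ => φ (Fr p) = v).card : ℕ) : ℝ) with hπv
  set Av : ℝ → ℝ := fun v => (((Finset.univ.filter fun g : N ≃ₐ[ℚ] N => φ g = v).card : ℕ) : ℝ)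
    with hAv
  set Sv : ℝ → ℝ := fun v =>
    ∑ g ∈ Finset.univ.filter (fun g : N ≃ₐ[ℚ] N => φ g = v), (if g ∈ K₁ then (1 : ℝ) else -1) with hSv
  set Mv : ℝ → ℝ := fun v => (Av v * Li - θ * Sv v * Lb) / G₀ with hMv
  -- the level-set estimate from `conjInvariant_PNT_pi`
  have hlevel : ∀ v : ℝ, |πv v - Mv v| ≤ ε * Mv v := by
    intro v
    have hm := hS {g : N ≃ₐ[ℚ] N | φ g = v} (conjInvariant_levelSet φ hφ v) x hx₀
    obtain ⟨e1, e2, e3⟩ := natCard_levelSet_eq φ v K₁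
    -- the subset predicate count is the `Fr`-count
    have hcount : ((Nat.primesLE ⌊x⌋₊).filter (fun p : ℕ => ¬ ((p : ℤ) ∣ NumberField.discr N) ∧
        ∃ (Q : Ideal (𝓞 N)) (_ : Q.IsMaximal) (_ : Q.LiesOver (span {(p : ℤ)})) (φ' : N ≃ₐ[ℚ] N),
          IsArithFrobAt ℤ φ' Q ∧ Q.inertia (N ≃ₐ[ℚ] N) = ⊥ ∧
            φ' ∈ ({g : N ≃ₐ[ℚ] N | φ g = v} : Set (N ≃ₐ[ℚ] N)))).card =
        (s.filter fun p : ℕ => φ (Fr p) = v).card := by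
      rw [hs, Finset.filter_filter]
      congr 1
      refine Finset.filter_congr fun p hp => ?_
      have hp' := (Nat.mem_primesLE.mp hp).2
      constructor
      · rintro ⟨hpN, hex⟩
        obtain ⟨Q₀, hQ₀, hQ₀p, hφ₀, hI₀⟩ := hFr p hp' hpN
        have := (subsetPred_iff_mem hQ₀ hQ₀p hφ₀ hI₀ (conjInvariant_levelSet φ hφ v)).mp hex
        exact ⟨hpN, this⟩
      · rintro ⟨hpN, hv⟩
        obtain ⟨Q₀, hQ₀, hQ₀p, hφ₀, hI₀⟩ := hFr p hp' hpN
        exact ⟨hpN, (subsetPred_iff_mem hQ₀ hQ₀p hφ₀ hI₀ (conjInvariant_levelSet φ hφ v)).mpr hv⟩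
    rw [hcount, e1, e2, e3, ← sum_filter_sign_eq φ v K₁] at hm
    exact hm
  -- rewrite the three sums along the level sets of `φ`
  have hmapsG : ∀ g ∈ (Finset.univ : Finset (N ≃ₐ[ℚ] N)), φ g ∈ V := fun g _ =>
    Finset.mem_image_of_mem φ (Finset.mem_univ g)
  have hmapsP : ∀ p ∈ s, φ (Fr p) ∈ V := fun p _ => Finset.mem_image_of_mem φ (Finset.mem_univ _)
  have hLHS : ∑ p ∈ s, φ (Fr p) = ∑ v ∈ V, πv v * v :=
    sum_eq_sum_card_filter_mul s (fun p => φ (Fr p)) V hmapsP id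
  have hsumφ : ∑ g : N ≃ₐ[ℚ] N, φ g = ∑ v ∈ V, Av v * v :=
    sum_eq_sum_card_filter_mul Finset.univ φ V hmapsG id
  have hsumabs : ∑ g : N ≃ₐ[ℚ] N, |φ g| = ∑ v ∈ V, Av v * |v| :=
    sum_eq_sum_card_filter_mul Finset.univ φ V hmapsG (fun v => |v|)
  have hsumχ : ∑ g : N ≃ₐ[ℚ] N, φ g * (if g ∈ K₁ then (1 : ℝ) else -1) = ∑ v ∈ V, v * Sv v := by
    rw [sum_eq_sum_sum_filter Finset.univ φ V hmapsG]
    refine Finset.sum_congr rfl fun v _ => ?_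
    rw [hSv, Finset.mul_sum]
    refine Finset.sum_congr rfl fun g hg => ?_
    rw [(Finset.mem_filter.mp hg).2]
  -- main term and error as sums over `V`
  have hmain : ((∑ g : N ≃ₐ[ℚ] N, φ g) * Li -
      θ * (∑ g : N ≃ₐ[ℚ] N, φ g * (if g ∈ K₁ then (1 : ℝ) else -1)) * Lb) / G₀ =
      ∑ v ∈ V, v * Mv v := by
    rw [hsumφ, hsumχ]
    have : ∀ v ∈ V, v * Mv v = (Av v * v) * (Li / G₀) - θ * (v * Sv v) * (Lb / G₀) := by
      intro v _; rw [hMv]; ring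
    rw [Finset.sum_congr rfl this, Finset.sum_sub_distrib, ← Finset.sum_mul, ← Finset.sum_mul,
      ← Finset.mul_sum]
    ring
  have herr : (∑ g : N ≃ₐ[ℚ] N, |φ g|) * (Li + θ * Lb) / G₀ = ∑ v ∈ V, |v| * (Av v * (Li + θ * Lb) / G₀) := by
    rw [hsumabs, Finset.sum_mul, Finset.sum_div]
    refine Finset.sum_congr rfl fun v _ => ?_
    ring
  -- `M_v ≤ A_v (Li + θ Lb)/G₀` since `|S_v| ≤ A_v`
  have hSvle : ∀ v : ℝ, |Sv v| ≤ Av v := by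
    intro v
    rw [hSv, hAv]
    refine (Finset.abs_sum_le_sum_abs _ _).trans ?_
    have : ∀ g ∈ Finset.univ.filter (fun g : N ≃ₐ[ℚ] N => φ g = v),
        |(if g ∈ K₁ then (1 : ℝ) else -1)| = 1 := by
      intro g _; split_ifs <;> simp
    rw [Finset.sum_congr rfl this, Finset.sum_const, nsmul_eq_mul, mul_one]
  have hMvle : ∀ v : ℝ, Mv v ≤ Av v * (Li + θ * Lb) / G₀ := by
    intro v
    rw [hMv, div_le_div_iff_of_pos_right hG0]
    have h2 : -(θ * Sv v * Lb) ≤ Av v * (θ * Lb) := by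
      have h3 : |θ * Sv v * Lb| ≤ Av v * (θ * Lb) := by
        rw [show θ * Sv v * Lb = Sv v * (θ * Lb) by ring, abs_mul, abs_of_nonneg hθLi]
        exact mul_le_mul_of_nonneg_right (hSvle v) hθLi
      have := neg_abs_le (θ * Sv v * Lb)
      linarith
    nlinarith
  have hMv0 : ∀ v : ℝ, 0 ≤ Mv v := by
    intro v
    have := hlevel v
    have h2 : 0 ≤ ε * Mv v := le_trans (abs_nonneg _) this
    nlinarith
  -- assemble
  rw [hLHS, hmain, herr, ← Finset.sum_sub_distrib]
  calc |∑ v ∈ V, (πv v * v - v * Mv v)| ≤ ∑ v ∈ V, |πv v * v - v * Mv v| := Finset.abs_sum_le_sum_abs _ _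
    _ ≤ ∑ v ∈ V, |v| * (ε * Mv v) := by
        refine Finset.sum_le_sum fun v _ => ?_
        rw [show πv v * v - v * Mv v = v * (πv v - Mv v) by ring, abs_mul]
        exact mul_le_mul_of_nonneg_left (hlevel v) (abs_nonneg v)
    _ ≤ ∑ v ∈ V, |v| * (ε * (Av v * (Li + θ * Lb) / G₀)) := by
        refine Finset.sum_le_sum fun v _ => ?_
        exact mul_le_mul_of_nonneg_left (mul_le_mul_of_nonneg_left (hMvle v) hε.le) (abs_nonneg v)
    _ = ε * ∑ v ∈ V, |v| * (Av v * (Li + θ * Lb) / G₀) := by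
        rw [Finset.mul_sum]
        refine Finset.sum_congr rfl fun v _ => ?_
        ring

end Summit.QuantumAdvantage.QuantumAdvantage.Theorems.DegreeOnePrimesEscape

end
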